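import Mathlib
import HarnessLib
import Summits.NavierStokesRegularity.NavierStokesRegularity.Theorems.UnthreadedRigidityDoorUnthreadedRigidityThreadingJetsSplitDefs
import Summits.NavierStokesRegularity.NavierStokesRegularity.Theorems.UnthreadedRigidityDoorUnthreadedRigidityThreadingJetsSlice
import Summits.NavierStokesRegularity.NavierStokesRegularity.Theorems.UnthreadedRigidityDoorUnthreadedRigidityVirialHornShellFields

/-!
# Route `UnthreadedRigidityDoor`, item `UnthreadedRigidity` (W2, stmt-NavierStokesRegularity-27585) — THREADING JETS, SPLIT GLUE:
# (A) ∧ (B′) ⇒ the GENERIC slice law, and LEMMA SEP by name (LINE g11-1 «VIRIAL HORN» / g10-2 «PROFILE HORN»)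

Seat ns-crc-p1 g8 (director-ns dss_146 (1)), `--supports stmt-NavierStokesRegularity-27585 --as helper`.  Inputs BY NAME: the split Props
`OrderTwoLawSlice` (A), `VirialLemmaSlice` (B′), `OrderTwoSliceLawGeneric` (`…ThreadingJetsSplitDefs`), crc-p2 g8's LEMMA SEP
`VirialHorn.separableSliceOrderOneSilence` (`…VirialHornShellFields`, p706546) and this seat's reduction `separableOrderOneSilence_of_slice`
(`…ThreadingJetsSlice`, p704808); engine-1 g71's `IsSolidHarmonic.angForm_eq` / `contDiff_gradient` (`…VirialHornAngularJets`, p703890).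

* ★ `separableOrderOneSilence_holds : ProfileHorn.SeparableOrderOneSilence` — LEMMA SEP (the `l = 2` order-one silence of the classical solution
  issuing from a separable shell) is a TREE THEOREM by composition (L-part crc-p2, M-part crc-p1).
* `continuousAt_strainAmpL`, `continuous_angForm`, `continuous_pbr_of_contDiff` — continuity of the slice quantities off the centre.
* ★ `orderTwoSliceLawGeneric_of_split : OrderTwoLawSlice → VirialLemmaSlice → OrderTwoSliceLawGeneric` — THE GLUE: `fluxJetTwo ≡ 0` and (A) give
  `K(|y|)·Ψ(y) = 0` with `Ψ = α²{Y,|∇Y|²} − {Y, y·∇p₀}`; where `K(|y|) ≠ 0` this is `Ψ(y) = 0`; at the remaining `y ≠ 0` by the genericity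
  hypothesis (no plateau of `K`) and continuity of `Ψ` along the ray; at `y = 0` trivially; then (B′).  (The division by `K` is exactly the CARD's
  residual R1, here carried by the explicit hypothesis of `OrderTwoSliceLawGeneric`.)

HONEST FRAMING: glue/bookkeeping of one RUNG line's L-identity; (A) and (B′) themselves are NOT proved here; nothing here bears on
`UnthreadedRigidity` (27585), the door Target, W2 or Navier–Stokes regularity; no summit statement is proved.  MODEL/rung work. [folklore]
-/

noncomputable section

-- the summit and its single sub-problem share the name (CONVENTIONS §1), as in every Theorems file
set_option linter.dupNamespace false

namespace Summit.NavierStokesRegularity.NavierStokesRegularity.Theorems.UnthreadedRigidity.ThreadingJets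

open Set Function Filter Topology
open scoped RealInnerProductSpace InnerProductSpace ContDiff Laplacian
open Literature.Analysis.FluidPDE
open Summit.NavierStokesRegularity.NavierStokesRegularity.Theorems.UnthreadedRigidity.ProfileHorn (E3 SeparableOrderOneSilence)
open Summit.NavierStokesRegularity.NavierStokesRegularity.Theorems.UnthreadedRigidity.VirialHorn
  (IsSolidHarmonic VirialAdmissible sepShellL virialMoment angForm pbr det3 vortAmpL strainAmpL separableSliceOrderOneSilence)

/-! ### LEMMA SEP by name -/

/-- ★ **LEMMA SEP** (`ProfileHorn.SeparableOrderOneSilence`, LINE g10-2): the first one-sided threading jet of the classical solution on `[t₀,T)`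
issuing from a separable `l = 2` shell vanishes — crc-p2 g8's explicit-field L-part `VirialHorn.separableSliceOrderOneSilence` composed with this
seat's M-part `separableOrderOneSilence_of_slice`. [folklore] -/
theorem separableOrderOneSilence_holds : SeparableOrderOneSilence :=
  separableOrderOneSilence_of_slice separableSliceOrderOneSilence

/-! ### Continuity of the slice quantities off the centre -/

/-- The profile of a virial-admissible datum is continuously differentiable off the origin, so `α_l[H]` is continuous at every `r > 0`. [folklore] -/
theorem continuousAt_strainAmpL {l : ℕ} {H : ℝ → ℝ} (hH : VirialAdmissible l H) {r : ℝ} (hr : 0 < r) :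
    ContinuousAt (strainAmpL l H) r := by
  obtain ⟨h, hh, hHh⟩ := hH.1
  have hG : ContDiff ℝ (⊤ : ℕ∞) (fun s : ℝ => h (s ^ 2)) := hh.comp (contDiff_id.pow 2)
  have hev : ∀ s : ℝ, 0 < s → H =ᶠ[𝓝 s] fun s => h (s ^ 2) := fun s hs => by
    filter_upwards [Ioi_mem_nhds hs] with σ hσ
    exact hHh σ (le_of_lt hσ)
  have hH' : deriv H =ᶠ[𝓝 r] deriv (fun s : ℝ => h (s ^ 2)) := by
    filter_upwards [Ioi_mem_nhds hr] with σ hσ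
    exact (hev σ hσ).deriv_eq
  have hc1 : ContinuousAt H r :=
    (hG.continuous.continuousAt).congr (hev r hr).symm
  have hc2 : ContinuousAt (deriv H) r :=
    ((hG.continuous_deriv (by simp)).continuousAt).congr hH'.symm
  unfold strainAmpL
  exact (continuousAt_id.mul hc2).add (continuousAt_const.mul hc1)

/-- `det[a,b,c] = ⟪a × b, c⟫` (coordinates). [folklore] -/
theorem det3_eq_inner_cross (a b c : E3) : det3 a b c = ⟪cross a b, c⟫ := by
  simp [det3, cross, cross_apply, PiLp.inner_apply, Fin.sum_univ_three]
  ring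

/-- The angular form of a solid harmonic is continuous. [folklore] -/
theorem continuous_angForm {l : ℕ} {Y : E3 → ℝ} (hY : IsSolidHarmonic l Y) : Continuous (angForm Y) := by
  have e : angForm Y = fun y => 2 * ⟪cross y (gradient Y y), fderiv ℝ (gradient Y) y (gradient Y y)⟫ :=
    funext fun y => hY.angForm_eq y
  rw [e]
  have hg : Continuous (gradient Y) := hY.contDiff_gradient.continuous
  have hh : Continuous (fderiv ℝ (gradient Y)) := hY.contDiff_hessian.continuous
  have hc : Continuous fun y : E3 => cross y (gradient Y y) := by
    have : (fun y : E3 => cross y (gradient Y y)) = fun y => crossCLM y (gradient Y y) := by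
      funext y; rfl
    rw [this]
    exact crossCLM.continuous₂.comp (continuous_id.prodMk hg)
  exact continuous_const.mul ((hc.inner (hh.clm_apply hg)))

/-- The bracket `{Y, g}` of a solid harmonic with a smooth `g` is continuous. [folklore] -/
theorem continuous_pbr_of_contDiff {l : ℕ} {Y : E3 → ℝ} (hY : IsSolidHarmonic l Y) {g : E3 → ℝ}
    (hg : ContDiff ℝ (⊤ : ℕ∞) g) : Continuous (pbr Y g) := by
  have e : pbr Y g = fun y => ⟪cross y (gradient Y y), gradient g y⟫ := funext fun y => det3_eq_inner_cross _ _ _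
  rw [e]
  have hgY : Continuous (gradient Y) := hY.contDiff_gradient.continuous
  have hgg : Continuous (gradient g) :=
    (InnerProductSpace.toDual ℝ E3).symm.continuous.comp (hg.continuous_fderiv (by simp))
  have hc : Continuous fun y : E3 => cross y (gradient Y y) := by
    have : (fun y : E3 => cross y (gradient Y y)) = fun y => crossCLM y (gradient Y y) := by
      funext y; rfl
    rw [this]
    exact crossCLM.continuous₂.comp (continuous_id.prodMk hgY)
  exact hc.inner hgg

/-! ### The glue -/

/-- ★ **THE GLUE: (A) ∧ (B′) ⇒ the generic slice law.** [folklore] -/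
theorem orderTwoSliceLawGeneric_of_split (hA : OrderTwoLawSlice) (hB : VirialLemmaSlice) : OrderTwoSliceLawGeneric := by
  intro l x₀ Y H p₀ hl hY hH hK hsm hdiv hp hpoi hdec hjet ξ
  -- the slice quantity `Ψ`
  set g : E3 → ℝ := fun z => inner ℝ z (gradient p₀ (x₀ + z)) with hg_def
  set Ψ : E3 → ℝ := fun y => strainAmpL l H ‖y‖ ^ 2 * angForm Y y - pbr Y g y with hΨ_def
  -- (A) and `fluxJetTwo ≡ 0`: `K(|y|) Ψ(y) = 0`
  have hKΨ : ∀ y : E3, vortAmpL l H ‖y‖ * Ψ y = 0 := fun y => by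
    rw [hΨ_def]
    have h := hA l x₀ Y H p₀ hl hY hH hsm hdiv hp y
    rw [hjet (x₀ + y)] at h
    exact h.symm
  -- `g` is smooth, so `Ψ` is continuous off the centre
  have hgs : ContDiff ℝ (⊤ : ℕ∞) g := by
    have hgp : ContDiff ℝ (⊤ : ℕ∞) (gradient p₀) :=
      (InnerProductSpace.toDual ℝ E3).symm.contDiff.comp (hp.fderiv_right (m := (⊤ : ℕ∞)) (by exact_mod_cast le_top))
    have h1 : ContDiff ℝ (⊤ : ℕ∞) (fun z : E3 => gradient p₀ (x₀ + z)) := hgp.comp (contDiff_const.add contDiff_id)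
    exact contDiff_id.inner ℝ h1
  have hΨc : ∀ y : E3, y ≠ 0 → ContinuousAt Ψ y := fun y hy => by
    have h1 : ContinuousAt (fun y : E3 => strainAmpL l H ‖y‖) y :=
      (continuousAt_strainAmpL hH (norm_pos_iff.2 hy)).comp continuous_norm.continuousAt
    exact ((h1.pow 2).mul (continuous_angForm hY).continuousAt).sub (continuous_pbr_of_contDiff hY hgs).continuousAt
  -- `Ψ ≡ 0`
  have hΨ0 : ∀ y : E3, Ψ y = 0 := by
    intro y
    by_cases hy : y = 0
    · subst hy
      simp [hΨ_def, angForm, pbr, det3]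
    by_cases hKy : vortAmpL l H ‖y‖ = 0
    swap
    · exact (mul_eq_zero.1 (hKΨ y)).resolve_left hKy
    -- `K(|y|) = 0`: approach `y` along its ray by radii where `K ≠ 0`
    by_contra hne
    have hr : 0 < ‖y‖ := norm_pos_iff.2 hy
    have hopen : ∀ᶠ z in 𝓝 y, Ψ z ≠ 0 := (hΨc y hy).eventually_ne hne
    obtain ⟨δ, hδ, hball⟩ := Metric.eventually_nhds_iff.1 hopen
    set a : ℝ := max (‖y‖ - δ / 2) (‖y‖ / 2) with ha_def
    have ha0 : 0 < a := lt_of_lt_of_le (by linarith) (le_max_right _ _)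
    have hab : a < ‖y‖ + δ / 2 := max_lt (by linarith) (by linarith)
    obtain ⟨r, hrI, hKr⟩ := hK a (‖y‖ + δ / 2) ha0 hab
    have hr0 : 0 < r := ha0.trans hrI.1
    -- the point `z = (r/|y|) y` on the ray, at distance `|r − |y|| < δ`
    set z : E3 := (r / ‖y‖) • y with hz_def
    have hnz : ‖z‖ = r := by
      rw [hz_def, norm_smul, Real.norm_of_nonneg (by positivity), div_mul_cancel₀ _ hr.ne']
    have hdist : dist z y < δ := by
      rw [dist_eq_norm, hz_def]
      have e : (r / ‖y‖) • y - y = (r / ‖y‖ - 1) • y := by rw [sub_smul, one_smul]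
      rw [e, norm_smul, Real.norm_eq_abs]
      have e2 : |r / ‖y‖ - 1| * ‖y‖ = |r - ‖y‖| := by
        rw [show r / ‖y‖ - 1 = (r - ‖y‖) / ‖y‖ by field_simp, abs_div, abs_of_pos hr, div_mul_cancel₀ _ hr.ne']
      rw [e2, abs_lt]
      have h1 : ‖y‖ - δ / 2 ≤ a := le_max_left _ _
      constructor <;> linarith [hrI.1, hrI.2]
    have hΨz : Ψ z = 0 := by
      have h := hKΨ z
      rw [hnz] at h
      exact (mul_eq_zero.1 h).resolve_left hKr
    exact hball hdist hΨz
  -- (B′)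
  have hprem : ∀ y : E3, strainAmpL l H ‖y‖ ^ 2 * angForm Y y = pbr Y g y := fun y =>
    sub_eq_zero.1 (hΨ0 y)
  exact hB l x₀ Y H p₀ hl hY hH hsm hdiv hp hpoi hdec hprem ξ

end Summit.NavierStokesRegularity.NavierStokesRegularity.Theorems.UnthreadedRigidity.ThreadingJets

end
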